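import Summits.Langlands.Langlands.Theses.QuarterDeficit1951
import Summits.Langlands.Langlands.Theorems.QuarterDeficit1951CensusDeficit1951StubConjTransport

/-!
# Crux `QuarterDeficit1951.CensusDeficit1951` (stmt-Langlands-17933) — LINE `conjugate-pair-census`

Crux-strategist sketch (unit `cstrat-stmt-Langlands-17933-s1`, 2026-08-17): the typed DECOMPOSITION of
the certified-census crux along its one genuine symmetry.

* `stub_conjTransport` — complex conjugation `u ↦ conj ∘ u` carries the weight-0 cuspidal spectrum of
  `(Γ₀(N), χ)` onto that of `(Γ₀(N), χ⁻¹)` with the same Laplace eigenvalues and conjugate Hecke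
  eigenvalues; conjugating every box of a certified transcript (`im ↦ [-hi, -lo]`) gives a certified
  transcript for `χ⁻¹` with the same window / tolerance / primes, the same upper count and the same
  `violates` verdicts (the verdict arithmetic is invariant under `im ↦ -im` up to `min`/`max`
  commutations). Provable now (M–L), no computation.
* `stub_pairDeficit` — the computational core: certified deficit transcripts for ONE order-5 character
  `χ₀` and for `χ₀²` (one per complex-conjugate pair; verdict class computation).
* `CensusDeficit1951_of` — PROVED glue: the order-5 Dirichlet characters mod the prime 1951 are exactly
  `χ₀, χ₀², χ₀³ = (χ₀²)⁻¹, χ₀⁴ = χ₀⁻¹` (cyclicity of `(ℤ/1951)ˣ`, primitive 5th roots of unity), so the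
  two stubs give the crux for every order-5 `χ`.
-/

namespace Summit.Langlands.Langlands.Cruxes.CensusDeficit1951.ConjugatePairCensus

open Literature.NumberTheory.Automorphic

/-- **Stub 1 (conjugation transport of certified deficit censuses).** For every level `N`, character
`χ` and transcript `c`: if `c` is a certified Maass–Hecke trace census for `(N, χ)` with the deficit
verdict, then some transcript `c'` with the same window, tolerance and fingerprint primes is a
certified census for `(N, χ⁻¹)` with the deficit verdict (take `c'` = `c` with all boxes conjugated).
[folklore] -/
theorem stub_conjTransport :
    ∀ (N : ℕ) (χ : DirichletCharacter ℂ N) (c : MaassHeckeTraceCensus),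
      CertifiedMaassHeckeTraceCensus N χ c → c.certifiesDeficit = true →
      ∃ c' : MaassHeckeTraceCensus, c'.window = c.window ∧ c'.fpTol = c.fpTol ∧
        c'.fpPrimes = c.fpPrimes ∧ CertifiedMaassHeckeTraceCensus N χ⁻¹ c' ∧
        c'.certifiesDeficit = true :=
  -- LANDED (wave 1, p158923): `Theorems/QuarterDeficit1951CensusDeficit1951StubConjTransport.lean`
  Summit.Langlands.Langlands.Theorems.CensusDeficit1951.stub_conjTransport

/-- **Stub 2 (the two certified deficit censuses, one per conjugate pair).** There is an order-5
character `χ₀` mod 1951 such that both `χ₀` and `χ₀²` carry a certified deficit transcript with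
window `≥ 1/100`, tolerance `≥ 1/100`, fingerprint primes `⊆ {2,3,5,7,11,13}`.
Verdict class: computation (Arb run of the Selberg–Hecke trace formula). [folklore] -/
theorem stub_pairDeficit :
    ∃ χ₀ : DirichletCharacter ℂ 1951, orderOf χ₀ = 5 ∧
      (∃ c : MaassHeckeTraceCensus, (1 / 100 : ℚ) ≤ c.window ∧ (1 / 100 : ℚ) ≤ c.fpTol ∧
        (∀ p ∈ c.fpPrimes, p ∈ ({2, 3, 5, 7, 11, 13} : Finset ℕ)) ∧
        CertifiedMaassHeckeTraceCensus 1951 χ₀ c ∧ c.certifiesDeficit = true) ∧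
      (∃ c : MaassHeckeTraceCensus, (1 / 100 : ℚ) ≤ c.window ∧ (1 / 100 : ℚ) ≤ c.fpTol ∧
        (∀ p ∈ c.fpPrimes, p ∈ ({2, 3, 5, 7, 11, 13} : Finset ℕ)) ∧
        CertifiedMaassHeckeTraceCensus 1951 (χ₀ ^ 2) c ∧ c.certifiesDeficit = true) := by
  sorry

/-- **Classification of the order-5 characters mod 1951.** If `χ₀` and `χ` are Dirichlet characters
mod 1951 of order 5, then `χ ∈ {χ₀, χ₀², (χ₀²)⁻¹, χ₀⁻¹}`: `(ℤ/1951)ˣ` is cyclic (1951 is prime), a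
character is determined by its value at a generator `g`, `χ₀(g)` is a primitive 5th root of unity and
`χ(g)` is a 5th root of unity, hence a power `χ₀(g)^k`, `0 < k < 5`. [folklore] -/
theorem eq_pow_of_orderOf_eq_five (χ χ₀ : DirichletCharacter ℂ 1951) (hχ₀ : orderOf χ₀ = 5)
    (hχ : orderOf χ = 5) : χ = χ₀ ∨ χ = χ₀ ^ 2 ∨ χ = (χ₀ ^ 2)⁻¹ ∨ χ = χ₀⁻¹ := by
  haveI : Fact (Nat.Prime 1951) := ⟨by norm_num⟩
  obtain ⟨g, hg⟩ := IsCyclic.exists_generator (α := (ZMod 1951)ˣ)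
  have h5 : χ₀ ^ 5 = 1 := by rw [← hχ₀]; exact pow_orderOf_eq_one χ₀
  -- the value of `χ₀` at the generator is a primitive 5th root of unity
  have hζ5 : (χ₀ g) ^ 5 = 1 := by
    rw [← MulChar.pow_apply_coe, h5, MulChar.one_apply_coe]
  have hζ1 : χ₀ g ≠ 1 := by
    intro h1
    have hχ₀1 : χ₀ = 1 := by
      refine MulChar.ext fun a => ?_
      obtain ⟨m, rfl⟩ := Subgroup.mem_zpowers_iff.mp (hg a)
      have hu : MulChar.toUnitHom χ₀ g = 1 :=
        Units.ext (by rw [MulChar.coe_toUnitHom, Units.val_one]; exact h1)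
      rw [MulChar.one_apply_coe, ← MulChar.coe_toUnitHom, map_zpow, hu, one_zpow, Units.val_one]
    rw [hχ₀1, orderOf_one] at hχ₀
    exact absurd hχ₀ (by norm_num)
  have hprim : IsPrimitiveRoot (χ₀ g) 5 := by
    have hd : orderOf (χ₀ g) ∣ 5 := orderOf_dvd_of_pow_eq_one hζ5
    rcases (Nat.dvd_prime (by norm_num)).mp hd with h | h
    · exact absurd (orderOf_eq_one_iff.mp h) hζ1
    · exact IsPrimitiveRoot.iff_orderOf.mpr h
  -- the value of `χ` at the generator is a 5th root of unity, hence a power of `χ₀ g`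
  have hξ5 : (χ g) ^ 5 = 1 := by
    rw [← MulChar.pow_apply_coe, ← hχ, pow_orderOf_eq_one, MulChar.one_apply_coe]
  obtain ⟨k, hk, hkζ⟩ := hprim.eq_pow_of_pow_eq_one hξ5
  -- hence `χ = χ₀ ^ k` (characters agreeing at a generator of the unit group agree)
  have hχk : χ = χ₀ ^ k := by
    refine MulChar.ext fun a => ?_
    obtain ⟨m, rfl⟩ := Subgroup.mem_zpowers_iff.mp (hg a)
    have e2 : MulChar.toUnitHom χ g = MulChar.toUnitHom (χ₀ ^ k) g :=
      Units.ext (by rw [MulChar.coe_toUnitHom, MulChar.coe_toUnitHom, MulChar.pow_apply_coe, hkζ])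
    rw [← MulChar.coe_toUnitHom, ← MulChar.coe_toUnitHom, map_zpow, map_zpow, e2]
  interval_cases k
  · exfalso
    rw [pow_zero] at hχk
    rw [hχk, orderOf_one] at hχ
    exact absurd hχ (by norm_num)
  · left; rw [hχk, pow_one]
  · right; left; exact hχk
  · right; right; left
    rw [hχk, eq_inv_iff_mul_eq_one, ← pow_add]
    exact h5
  · right; right; right
    rw [hχk, eq_inv_iff_mul_eq_one, ← pow_succ]
    exact h5

/-- **Glue with TEXT binders** (the same theorem, Theses-free, is attached to the item as
`QuarterDeficit1951CensusDeficit1951Split.lean` for a `route edit --split … --glue-by`): transport + pair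
censuses ⇒ the crux's text. k = 1, 2 from the pair; k = 3, 4 by transport applied to `χ₀²`, `χ₀`. [folklore] -/
theorem censusDeficit1951_of_pieces
    (hT : ∀ (N : ℕ) (χ : DirichletCharacter ℂ N) (c : MaassHeckeTraceCensus),
      CertifiedMaassHeckeTraceCensus N χ c → c.certifiesDeficit = true →
      ∃ c' : MaassHeckeTraceCensus, c'.window = c.window ∧ c'.fpTol = c.fpTol ∧
        c'.fpPrimes = c.fpPrimes ∧ CertifiedMaassHeckeTraceCensus N χ⁻¹ c' ∧
        c'.certifiesDeficit = true)
    (hP : ∃ χ₀ : DirichletCharacter ℂ 1951, orderOf χ₀ = 5 ∧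
      (∃ c : MaassHeckeTraceCensus, (1 / 100 : ℚ) ≤ c.window ∧ (1 / 100 : ℚ) ≤ c.fpTol ∧
        (∀ p ∈ c.fpPrimes, p ∈ ({2, 3, 5, 7, 11, 13} : Finset ℕ)) ∧
        CertifiedMaassHeckeTraceCensus 1951 χ₀ c ∧ c.certifiesDeficit = true) ∧
      (∃ c : MaassHeckeTraceCensus, (1 / 100 : ℚ) ≤ c.window ∧ (1 / 100 : ℚ) ≤ c.fpTol ∧
        (∀ p ∈ c.fpPrimes, p ∈ ({2, 3, 5, 7, 11, 13} : Finset ℕ)) ∧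
        CertifiedMaassHeckeTraceCensus 1951 (χ₀ ^ 2) c ∧ c.certifiesDeficit = true)) :
    ∀ χ : DirichletCharacter ℂ 1951, orderOf χ = 5 →
      ∃ c : MaassHeckeTraceCensus, (1 / 100 : ℚ) ≤ c.window ∧ (1 / 100 : ℚ) ≤ c.fpTol ∧
        (∀ p ∈ c.fpPrimes, p ∈ ({2, 3, 5, 7, 11, 13} : Finset ℕ)) ∧
        CertifiedMaassHeckeTraceCensus 1951 χ c ∧ c.certifiesDeficit = true := by
  intro χ hχ
  obtain ⟨χ₀, hχ₀, h1, h2⟩ := hP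
  -- transport of a bounded certified deficit transcript from `ψ` to `ψ⁻¹`
  have transport : ∀ ψ : DirichletCharacter ℂ 1951,
      (∃ c : MaassHeckeTraceCensus, (1 / 100 : ℚ) ≤ c.window ∧ (1 / 100 : ℚ) ≤ c.fpTol ∧
        (∀ p ∈ c.fpPrimes, p ∈ ({2, 3, 5, 7, 11, 13} : Finset ℕ)) ∧
        CertifiedMaassHeckeTraceCensus 1951 ψ c ∧ c.certifiesDeficit = true) →
      (∃ c : MaassHeckeTraceCensus, (1 / 100 : ℚ) ≤ c.window ∧ (1 / 100 : ℚ) ≤ c.fpTol ∧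
        (∀ p ∈ c.fpPrimes, p ∈ ({2, 3, 5, 7, 11, 13} : Finset ℕ)) ∧
        CertifiedMaassHeckeTraceCensus 1951 ψ⁻¹ c ∧ c.certifiesDeficit = true) := by
    rintro ψ ⟨c, hw, ht, hp, hc, hv⟩
    obtain ⟨c', hw', ht', hp', hc', hv'⟩ := hT 1951 ψ c hc hv
    refine ⟨c', ?_, ?_, fun p hpp => hp p ?_, hc', hv'⟩
    · rw [hw']; exact hw
    · rw [ht']; exact ht
    · rw [← hp']; exact hpp
  rcases eq_pow_of_orderOf_eq_five χ χ₀ hχ₀ hχ with rfl | rfl | rfl | rfl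
  · exact h1
  · exact h2
  · exact transport _ h2
  · exact transport _ h1

/-- **The composition (kernel-checked): the two registered stubs, BY NAME, give the crux BY NAME.**
[folklore] -/
theorem CensusDeficit1951_of :
    Summit.Langlands.Langlands.Theses.QuarterDeficit1951.CensusDeficit1951 := by
  intro χ hχ
  exact censusDeficit1951_of_pieces stub_conjTransport stub_pairDeficit χ hχ

/-- **The pair stub is a genuine restriction of the crux** (converse bookkeeping, proved): the crux and
any order-5 character give `stub_pairDeficit`'s statement. [folklore] -/
theorem pair_of_censusDeficit1951
    (hC : Summit.Langlands.Langlands.Theses.QuarterDeficit1951.CensusDeficit1951)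
    (hex : ∃ χ₀ : DirichletCharacter ℂ 1951, orderOf χ₀ = 5) :
    ∃ χ₀ : DirichletCharacter ℂ 1951, orderOf χ₀ = 5 ∧
      (∃ c : MaassHeckeTraceCensus, (1 / 100 : ℚ) ≤ c.window ∧ (1 / 100 : ℚ) ≤ c.fpTol ∧
        (∀ p ∈ c.fpPrimes, p ∈ ({2, 3, 5, 7, 11, 13} : Finset ℕ)) ∧
        CertifiedMaassHeckeTraceCensus 1951 χ₀ c ∧ c.certifiesDeficit = true) ∧
      (∃ c : MaassHeckeTraceCensus, (1 / 100 : ℚ) ≤ c.window ∧ (1 / 100 : ℚ) ≤ c.fpTol ∧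
        (∀ p ∈ c.fpPrimes, p ∈ ({2, 3, 5, 7, 11, 13} : Finset ℕ)) ∧
        CertifiedMaassHeckeTraceCensus 1951 (χ₀ ^ 2) c ∧ c.certifiesDeficit = true) := by
  obtain ⟨χ₀, hχ₀⟩ := hex
  have hχ₀2 : orderOf (χ₀ ^ 2) = 5 := by
    have hcop : (orderOf χ₀).Coprime 2 := by rw [hχ₀]; norm_num
    rw [hcop.orderOf_pow, hχ₀]
  exact ⟨χ₀, hχ₀, hC χ₀ hχ₀, hC (χ₀ ^ 2) hχ₀2⟩

end Summit.Langlands.Langlands.Cruxes.CensusDeficit1951.ConjugatePairCensus
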